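import Summits.AtomisticToContinuum.Crystallization.Theorems.PalmUnimodularRigidityShellsToBarlowChartTransportOpsDefs

/-!
# Line `develop-the-model-growth-descent` (crux `ShellsToBarlowChart`, stmt-AtomisticToContinuum-9227): pattern facts, part 2

Decidable facts about the two integer kissing patterns `fcc3Int`, `hcpInt` (labels at squared
norm `18`) used by the frame transports of `stub_transportSystem`: hexagons, even/odd caps,
their filters, apexes, distance tables, lower caps and the letters read on them.  Every fact was
first verified by brute force (work/sim/facts.py of the lead's folder) and is proved here by
`decide` (split into small files so that each elaborates quickly).  All `[folklore]`
(finite checks on the cuboctahedron / anticuboctahedron, HalesDSP2012 §1.3).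
-/

namespace Summit.AtomisticToContinuum.Crystallization.Theorems.PalmUnimodularRigidityShellsToBarlowChart

open Literature.Geometry.DiscreteGeometry

/-- The FCC spectrum has no `48` (no `√(8/3)` pairs): a `48` read in a chart forces the HCP pattern. [folklore] -/
theorem sqNormInt_sub_ne_48_of_fcc3Int : ∀ a ∈ fcc3Int, ∀ b ∈ fcc3Int, sqNormInt (a - b) ≠ 48 := by
  decide

/-- The odd cap is `capWith` of its apex. [folklore] -/
theorem capWith_oddCap : ∀ P : Finset (Fin 3 → ℤ), (P = fcc3Int ∨ P = hcpInt) →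
    ∀ a ∈ P, ∀ b ∈ P, ∀ c ∈ P, sqNormInt (a - b) = 18 → hexLabels a b ⊆ P → c ∉ hexLabels a b → c + a ∈ P → c + b ∈ P → capWith P a b c = ({c, c + a, c + b} : Finset (Fin 3 → ℤ)) := by
  rintro P (rfl | rfl) <;> decide

/-- In the odd cap, the element touching `a` (resp. `b`, `−a`, `−b`) is `c + a` (resp. `c + b`, `c`, `c`). [folklore] -/
theorem filter_oddCap : ∀ P : Finset (Fin 3 → ℤ), (P = fcc3Int ∨ P = hcpInt) →
    ∀ a ∈ P, ∀ b ∈ P, ∀ c ∈ P, sqNormInt (a - b) = 18 → hexLabels a b ⊆ P → c ∉ hexLabels a b → c + a ∈ P → c + b ∈ P → ({c, c + a, c + b} : Finset (Fin 3 → ℤ)).filter (fun e => sqNormInt (e - a) = 18) = {c + a} ∧ ({c, c + a, c + b} : Finset (Fin 3 → ℤ)).filter (fun e => sqNormInt (e - b) = 18) = {c + b} ∧ ({c, c + a, c + b} : Finset (Fin 3 → ℤ)).filter (fun e => sqNormInt (e + a) = 18) = {c} ∧ ({c, c + a, c + b} : Finset (Fin 3 → ℤ)).filter (fun e => sqNormInt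 (e + b) = 18) = {c} := by
  rintro P (rfl | rfl) <;> decide

/-- In the odd cap the apex is `c`. [folklore] -/
theorem apex_oddCap : ∀ P : Finset (Fin 3 → ℤ), (P = fcc3Int ∨ P = hcpInt) →
    ∀ a ∈ P, ∀ b ∈ P, ∀ c ∈ P, sqNormInt (a - b) = 18 → hexLabels a b ⊆ P → c ∉ hexLabels a b → c + a ∈ P → c + b ∈ P → ∀ e ∈ ({c, c + a, c + b} : Finset (Fin 3 → ℤ)), ((e - a ∈ ({c, c + a, c + b} : Finset (Fin 3 → ℤ)) ∧ e - b ∈ ({c, c + a, c + b} : Finset (Fin 3 → ℤ))) ∨ (e + a ∈ ({c, c + a, c + b} : Finset (Fin 3 → ℤ)) ∧ e + b ∈ ({c, c + a, c + b} : Finset (Fin 3 → ℤ)))) → e = c := by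
  rintro P (rfl | rfl) <;> decide

/-- Odd cap: the table of squared distances to the hexagon used by the transports. [folklore] -/
theorem dist_oddCap : ∀ P : Finset (Fin 3 → ℤ), (P = fcc3Int ∨ P = hcpInt) →
    ∀ a ∈ P, ∀ b ∈ P, ∀ c ∈ P, sqNormInt (a - b) = 18 → hexLabels a b ⊆ P → c ∉ hexLabels a b → c + a ∈ P → c + b ∈ P → sqNormInt (-a - c) = 18 ∧ sqNormInt (-b - c) = 18 ∧ sqNormInt (a - c) = 54 ∧ sqNormInt (b - c) = 54 ∧ sqNormInt (b - (c + a)) = 36 ∧ sqNormInt (a - (c + b)) = 36 ∧ sqNormInt (a - b - (c + a)) = 18 ∧ sqNormInt (b - a - (c + b)) = 18 ∧ sqNormInt (a - (c + a)) = 18 ∧ sqNormInt (b - (c + b)) = 18 ∧ sqNormInt (c - (c + a)) = 18 ∧ sqNormInt (c - (c + b)) = 18 ∧ sqNormInt (c + a - (c + b)) = 18 := by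
  rintro P (rfl | rfl) <;> decide

/-- V-step (even): for three mutually touching one-sided labels `ξ, η, ζ` (the lower sites `x, Ix, Jx` seen from `u`) the directions `η − ξ, ζ − ξ` with the cap opposite to `ξ` form a valid frame whose lower cap is `{ξ, η, ζ}`, read as letter `+1`. [folklore] -/
theorem isFrame_capOpp_even : ∀ P : Finset (Fin 3 → ℤ), (P = fcc3Int ∨ P = hcpInt) →
    ∀ ξ ∈ P, ∀ η ∈ P, ∀ ζ ∈ P, sqNormInt (ξ - η) = 18 → sqNormInt (ξ - ζ) = 18 → sqNormInt (η - ζ) = 18 → ((-ξ ∈ P ∧ -η ∈ P ∧ -ζ ∈ P) ∨ (-ξ ∉ P ∧ -η ∉ P ∧ -ζ ∉ P)) → IsFrame P (η - ξ) (ζ - ξ) (capOpp P (η - ξ) (ζ - ξ) ξ) ∧ lowerCap P (η - ξ) (ζ - ξ) (capOpp P (η - ξ) (ζ - ξ) ξ) = ({ξ, η, ζ} : Finset (Fin 3 → ℤ)) ∧ lowerParity (η - ξ) (ζ - ξ) ({ξ, η, ζ} : Finset (Fin 3 → ℤ)) = 1 := by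
  rintro P (rfl | rfl) <;> decide

/-- V-step (odd): for three mutually touching one-sided labels `ξ, η, ζ` (the lower sites `x, I⁻¹x, J⁻¹x` seen from `u`) the directions `ξ − η, ξ − ζ` with the cap opposite to `ξ` form a valid frame whose lower cap is `{ξ, η, ζ}`, read as letter `−1`. [folklore] -/
theorem isFrame_capOpp_odd : ∀ P : Finset (Fin 3 → ℤ), (P = fcc3Int ∨ P = hcpInt) →
    ∀ ξ ∈ P, ∀ η ∈ P, ∀ ζ ∈ P, sqNormInt (ξ - η) = 18 → sqNormInt (ξ - ζ) = 18 → sqNormInt (η - ζ) = 18 → ((-ξ ∈ P ∧ -η ∈ P ∧ -ζ ∈ P) ∨ (-ξ ∉ P ∧ -η ∉ P ∧ -ζ ∉ P)) → IsFrame P (ξ - η) (ξ - ζ) (capOpp P (ξ - η) (ξ - ζ) ξ) ∧ lowerCap P (ξ - η) (ξ - ζ) (capOpp P (ξ - η) (ξ - ζ) ξ) = ({ξ, η, ζ} : Finset (Fin 3 → ℤ)) ∧ lowerParity (ξ - η) (ξ - ζ) ({ξ, η, ζ} : Finset (Fin 3 → ℤ)) = -1 := by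
  rintro P (rfl | rfl) <;> decide

/-- The two caps of a hexagon: the cap of a label `δ` outside the cap of `α` is the cap opposite to `α`. [folklore] -/
theorem capWithAny_eq_capOpp : ∀ P : Finset (Fin 3 → ℤ), (P = fcc3Int ∨ P = hcpInt) →
    ∀ a ∈ P, ∀ b ∈ P, ∀ α ∈ P, ∀ δ ∈ P, sqNormInt (a - b) = 18 → hexLabels a b ⊆ P → α ∉ hexLabels a b → δ ∉ hexLabels a b → α ≠ δ → sqNormInt (α - δ) ≠ 18 → capWithAny P a b {δ} = capOpp P a b α := by
  rintro P (rfl | rfl) <;> decide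

/-- The lower cap of an even frame is a translation cap with some apex `d`; `d` reads the letter below; distances `c ↔ lower cap`. [folklore] -/
theorem lowerCap_evenCap : ∀ P : Finset (Fin 3 → ℤ), (P = fcc3Int ∨ P = hcpInt) →
    ∀ a ∈ P, ∀ b ∈ P, ∀ c ∈ P, sqNormInt (a - b) = 18 → hexLabels a b ⊆ P → c ∉ hexLabels a b → c - a ∈ P → c - b ∈ P → ∃ d ∈ lowerCap P a b ({c, c - a, c - b} : Finset (Fin 3 → ℤ)), (lowerCap P a b ({c, c - a, c - b} : Finset (Fin 3 → ℤ)) = {d, d + a, d + b} ∧ lowerParity a b (lowerCap P a b ({c, c - a, c - b} : Finset (Fin 3 → ℤ))) = 1 ∧ (sqNormInt (c - d) = 72 ∨ sqNormInt (c - d) = 48)) ∨ (lowerCap P a b ({c, c - a, c - b} : Finset (Fin 3 → ℤ)) = {d, d - a, d - b} ∧ lowerParity a b (lowerCap P a b ({c, c - a, c - b} : Finset (Fin 3 → ℤ))) = -1 ∧ (sqNormInt (c - d) = 72 ∨ sqNormInt (c - d) = 48)) := by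
  rintro P (rfl | rfl) <;> decide

/-- The lower cap of an odd frame is a translation cap with some apex `d`. [folklore] -/
theorem lowerCap_oddCap : ∀ P : Finset (Fin 3 → ℤ), (P = fcc3Int ∨ P = hcpInt) →
    ∀ a ∈ P, ∀ b ∈ P, ∀ c ∈ P, sqNormInt (a - b) = 18 → hexLabels a b ⊆ P → c ∉ hexLabels a b → c + a ∈ P → c + b ∈ P → ∃ d ∈ lowerCap P a b ({c, c + a, c + b} : Finset (Fin 3 → ℤ)), (lowerCap P a b ({c, c + a, c + b} : Finset (Fin 3 → ℤ)) = {d, d + a, d + b} ∧ lowerParity a b (lowerCap P a b ({c, c + a, c + b} : Finset (Fin 3 → ℤ))) = 1 ∧ (sqNormInt (c - d) = 72 ∨ sqNormInt (c - d) = 48)) ∨ (lowerCap P a b ({c, c + a, c + b} : Finset (Fin 3 → ℤ)) = {d, d - a, d - b} ∧ lowerParity a b (lowerCap P a b ({c, c + a, c + b} : Finset (Fin 3 → ℤ))) = -1 ∧ (sqNormInt (c - d) = 72 ∨ sqNormInt (c - d) = 48)) := by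
  rintro P (rfl | rfl) <;> decide

/-- Squared distances inside a pattern hexagon spanned by `(a, b)`. [folklore] -/
theorem dist_hexagon : ∀ P : Finset (Fin 3 → ℤ), (P = fcc3Int ∨ P = hcpInt) →
    ∀ a ∈ P, ∀ b ∈ P, sqNormInt (a - b) = 18 → hexLabels a b ⊆ P → sqNormInt a = 18 ∧ sqNormInt b = 18 ∧ sqNormInt (a + b) = 54 ∧ sqNormInt (2 • a - b) = 54 ∧ sqNormInt (2 • b - a) = 54 ∧ sqNormInt (a - (a - b)) = 18 ∧ sqNormInt (b - (b - a)) = 18 ∧ sqNormInt (a - (b - a)) = 54 ∧ sqNormInt (b - (a - b)) = 54 ∧ sqNormInt (a + a) = 72 ∧ sqNormInt (-a - (b - a)) = 18 ∧ sqNormInt (-b - (a - b)) = 18 := by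
  rintro P (rfl | rfl) <;> decide

end Summit.AtomisticToContinuum.Crystallization.Theorems.PalmUnimodularRigidityShellsToBarlowChart
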